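import Literature.NumberTheory.EllipticCurves.PeriodIndexLocalTriviality
import Mathlib.NumberTheory.NumberField.Completion.InfinitePlace
import Mathlib.Analysis.SpecialFunctions.Pow.Real
import HarnessLib

/-!
# Local conditions at the infinite places: totally positive elements (Clark–Sharif (SC1'))

`Proofs`-style file (theorems only; no definitions, no named facts) under the provefact seat on
`Literature.NumberTheory.EllipticCurves.ClarkSharif2010_thm2` (Clark–Sharif 2010, Theorem 2).
In the reduction `ClarkSharif2010_thm2_of_kummerClasses` (`PeriodIndexThm2Reduction`) the local
triviality of the classes `η_i = cores Φ(a_i, b_i)` at a place of `K` is deduced from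
"`a_i, b_i` are `P`-th powers in every completion of `k = K_P` above it"
(`map_coresH1_kummerPhi_mem_localRestrictionKer_of_exists_pow_eq`, `PeriodIndexLocalTriviality`).
At the **infinite** places this is where condition (SC1') of Clark–Sharif §3.4 — *"The primes
`v_i = (π_i)` and `v_i' = (π_i')` are principal, with totally positive generators `π_i` and
`π_i'`"* — enters: a totally positive element is a `P`-th power in every archimedean completion.
This file proves that statement in the embedded model `k_g = K_w(ι(g k)) ⊆ K̄_w` of the
completions of `k` used by `PeriodIndexLocalTriviality`:

* `isAlgClosed_of_ringEquiv_complex` — a field isomorphic to `ℂ` is algebraically closed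
  (universe-polymorphic replacement for `IsAlgClosed.of_ringEquiv`);
* `exists_mem_pow_eq_of_isAlgClosed` — over an algebraically closed base, `P`-th roots exist in
  every intermediate field of `K̄'/K'` (complex places);
* `exists_isAlgClosedLift_eq_I`, `isAlgClosedLift_algebraMap`,
  `eq_algebraMap_re_add_algebraMap_im_mul`, `mem_intermediateField_of_im_ne_zero`,
  `exists_mem_adjoin_pow_eq_of_pos` — for a base `K' ≅ ℝ` with the embedding
  `j = IsAlgClosed.lift : K̄' → ℂ`: every `y ∈ K̄'` is `re(j y) + im(j y)·i`; an intermediate field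
  containing a non-real element is all of `K̄'`; hence `x ∈ S` has a `P`-th root in `K'(S)` as
  soon as `x` is positive whenever all of `S` is real (real places);
* `exists_mem_adjoin_pow_eq_of_totallyPositive` — **the statement above** for an infinite place
  `w` of `K`, `g ∈ 𝔤_K` and a totally positive `a ∈ kˣ`;
* `map_coresH1_kummerPhi_mem_localRestrictionKer_infinitePlace` — consequently
  `η = α_* cores Φ(a, b) ∈ W.localRestrictionKer K_w` for totally positive `a, b` (the
  `T`-clause of `ClarkSharif2010_thm2_of_primePow_torsion_index` / of hypothesis `h` of
  `ClarkSharif2010_thm2_of_kummerClasses`).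

## References

* P. L. Clark, S. Sharif, *Period, index and potential Ш*, Algebra & Number Theory 4 (2010)
  151–174, §3.1 (SC1), §3.4 (SC1'), §3.6; arXiv:0811.3019 read. [ClarkSharif2010]
-/

noncomputable section

open scoped Classical NumberField

universe u

namespace Literature.NumberTheory.EllipticCurves

open GaloisRepresentations Field NumberField

section Transport

variable {K' : Type u} [Field K']

/-- A field isomorphic to `ℂ` is algebraically closed. [folklore] -/
theorem isAlgClosed_of_ringEquiv_complex (e : K' ≃+* ℂ) : IsAlgClosed K' := by
  refine IsAlgClosed.of_exists_root _ fun p _ hp ↦ ?_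
  have hdeg : (p.map e.toRingHom).degree ≠ 0 := by
    rw [Polynomial.degree_map]
    exact (Polynomial.degree_pos_of_irreducible hp).ne'
  obtain ⟨z, hz⟩ := IsAlgClosed.exists_root (p.map e.toRingHom) hdeg
  refine ⟨e.symm z, e.injective ?_⟩
  have h1 : e (p.eval (e.symm z)) = p.eval₂ e.toRingHom (e.toRingHom (e.symm z)) :=
    (Polynomial.eval₂_hom e.toRingHom (e.symm z)).symm
  rw [h1, map_zero]
  change Polynomial.eval₂ e.toRingHom (e (e.symm z)) p = 0
  rw [e.apply_symm_apply, ← Polynomial.eval_map]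
  exact hz

end Transport

section AlgClosedBase

variable {K' : Type u} [Field K']

/-- Over an algebraically closed base every element of `K̄'` has `P`-th roots in every
intermediate field (indeed in the base). [folklore] -/
theorem exists_mem_pow_eq_of_isAlgClosed [IsAlgClosed K']
    (F : IntermediateField K' (AlgebraicClosure K')) (x : AlgebraicClosure K') {P : ℕ}
    (hP : 0 < P) : ∃ r ∈ F, r ^ P = x := by
  obtain ⟨x₀, rfl⟩ :=
    (IsAlgClosed.algebraMap_bijective_of_isIntegral (k := K') (K := AlgebraicClosure K')).2 x
  obtain ⟨y, hy⟩ := IsAlgClosed.exists_pow_nat_eq x₀ hP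
  exact ⟨algebraMap K' _ y, F.algebraMap_mem y, by rw [← map_pow, hy]⟩

end AlgClosedBase

section RealBase

variable {K' : Type u} [Field K']

/-- There is `i ∈ K̄'` with `j i = I` (`j = IsAlgClosed.lift : K̄' → ℂ` for any `K'`-algebra
structure on `ℂ`). [folklore] -/
theorem exists_isAlgClosedLift_eq_I [Algebra K' ℂ] :
    ∃ i : AlgebraicClosure K', (IsAlgClosed.lift : AlgebraicClosure K' →ₐ[K'] ℂ) i = Complex.I := by
  set j := (IsAlgClosed.lift : AlgebraicClosure K' →ₐ[K'] ℂ)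
  obtain ⟨i, hi⟩ := IsAlgClosed.exists_pow_nat_eq (-1 : AlgebraicClosure K') two_pos
  have hji : (j i) ^ 2 = -1 := by rw [← map_pow, hi, map_neg, map_one]
  have h0 : (j i - Complex.I) * (j i + Complex.I) = 0 := by
    have : (j i - Complex.I) * (j i + Complex.I) = (j i) ^ 2 - Complex.I ^ 2 := by ring
    rw [this, hji, Complex.I_sq, sub_self]
  rcases mul_eq_zero.mp h0 with h | h
  · exact ⟨i, sub_eq_zero.mp h⟩
  · exact ⟨-i, by rw [map_neg, eq_neg_of_add_eq_zero_left h, neg_neg]⟩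

variable (e : K' ≃+* ℝ) [Algebra K' ℂ] (halg : ∀ x : K', algebraMap K' ℂ x = (e x : ℂ))
include halg

/-- The chosen `K'`-embedding `j : K̄' → ℂ` on `K'`. [folklore] -/
theorem isAlgClosedLift_algebraMap (x : K') :
    (IsAlgClosed.lift : AlgebraicClosure K' →ₐ[K'] ℂ) (algebraMap K' _ x) = (e x : ℂ) := by
  rw [AlgHom.commutes, halg]

/-- `y = re(j y) + im(j y) · i` in `K̄'`. [folklore] -/
theorem eq_algebraMap_re_add_algebraMap_im_mul {i : AlgebraicClosure K'}
    (hi : (IsAlgClosed.lift : AlgebraicClosure K' →ₐ[K'] ℂ) i = Complex.I)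
    (y : AlgebraicClosure K') :
    y = algebraMap K' _ (e.symm ((IsAlgClosed.lift : AlgebraicClosure K' →ₐ[K'] ℂ) y).re) +
      algebraMap K' _ (e.symm ((IsAlgClosed.lift : AlgebraicClosure K' →ₐ[K'] ℂ) y).im) * i := by
  set j := (IsAlgClosed.lift : AlgebraicClosure K' →ₐ[K'] ℂ)
  apply j.toRingHom.injective
  change j y = j _
  rw [map_add, map_mul, isAlgClosedLift_algebraMap e halg, isAlgClosedLift_algebraMap e halg,
    e.apply_symm_apply, e.apply_symm_apply, hi, Complex.re_add_im]

/-- An intermediate field of `K̄'/K'` containing a non-real element is everything. [folklore] -/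
theorem mem_intermediateField_of_im_ne_zero (F : IntermediateField K' (AlgebraicClosure K'))
    {z : AlgebraicClosure K'} (hz : z ∈ F) (hzi : ((IsAlgClosed.lift : AlgebraicClosure K' →ₐ[K'] ℂ) z).im ≠ 0)
    (y : AlgebraicClosure K') : y ∈ F := by
  set j := (IsAlgClosed.lift : AlgebraicClosure K' →ₐ[K'] ℂ)
  obtain ⟨i, hi⟩ := exists_isAlgClosedLift_eq_I (K' := K')
  have hiF : i ∈ F := by
    have hieq : i = (z - algebraMap K' _ (e.symm (j z).re)) *
        algebraMap K' _ (e.symm ((j z).im)⁻¹) := by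
      apply j.toRingHom.injective
      change j i = j _
      rw [map_mul, map_sub, isAlgClosedLift_algebraMap e halg, isAlgClosedLift_algebraMap e halg,
        e.apply_symm_apply, e.apply_symm_apply, hi]
      have hz' : j z - ((j z).re : ℂ) = ((j z).im : ℂ) * Complex.I := by
        rw [sub_eq_iff_eq_add', Complex.re_add_im]
      rw [hz', Complex.ofReal_inv, mul_comm ((j z).im : ℂ), mul_assoc,
        mul_inv_cancel₀ (Complex.ofReal_ne_zero.mpr hzi), mul_one]
    rw [hieq]
    exact F.mul_mem (F.sub_mem hz (F.algebraMap_mem _)) (F.algebraMap_mem _)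
  rw [eq_algebraMap_re_add_algebraMap_im_mul e halg hi y]
  exact F.add_mem (F.algebraMap_mem _) (F.mul_mem (F.algebraMap_mem _) hiF)

/-- **`P`-th roots in `K'(S)` over a real closed base `K' ≅ ℝ`**: if either `S` contains a
non-real element (then `K'(S) = K̄'`), or all of `S` is real and `x ∈ S` is positive, then `x`
has a `P`-th root in `K'(S)`. [folklore] -/
theorem exists_mem_adjoin_pow_eq_of_pos (S : Set (AlgebraicClosure K')) {x : AlgebraicClosure K'}
    (hx : x ∈ S)
    (hpos : (∀ y ∈ S, ((IsAlgClosed.lift : AlgebraicClosure K' →ₐ[K'] ℂ) y).im = 0) →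
      0 < ((IsAlgClosed.lift : AlgebraicClosure K' →ₐ[K'] ℂ) x).re)
    {P : ℕ} (hP : 0 < P) : ∃ r ∈ IntermediateField.adjoin K' S, r ^ P = x := by
  set j := (IsAlgClosed.lift : AlgebraicClosure K' →ₐ[K'] ℂ)
  by_cases hS : ∀ y ∈ S, (j y).im = 0
  · have ht := hpos hS
    refine ⟨algebraMap K' _ (e.symm (((j x).re) ^ (P⁻¹ : ℝ))),
      IntermediateField.algebraMap_mem _ _, ?_⟩
    apply j.toRingHom.injective
    change j _ = j x
    rw [map_pow, isAlgClosedLift_algebraMap e halg, e.apply_symm_apply, ← Complex.ofReal_pow,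
      Real.rpow_inv_natCast_pow ht.le hP.ne']
    apply Complex.ext
    · rw [Complex.ofReal_re]
    · rw [Complex.ofReal_im, hS x hx]
  · simp only [not_forall, exists_prop] at hS
    obtain ⟨z, hzS, hzi⟩ := hS
    obtain ⟨r, hr⟩ := IsAlgClosed.exists_pow_nat_eq x hP
    exact ⟨r, mem_intermediateField_of_im_ne_zero e halg _
      (IntermediateField.subset_adjoin K' S hzS) hzi r, hr⟩

end RealBase

section InfinitePlaces

variable {K : Type u} [Field K] {k : IntermediateField K (AlgebraicClosure K)} {P : ℕ} [NeZero P]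

/-- **Totally positive elements are `P`-th powers in every completion of `k` above an infinite
place** (the role of (SC1') "with totally positive generators `π_i` and `π_i'`" in Clark–Sharif
§3.4, cf. (SC1) §3.1: at the archimedean places nothing obstructs).  Let `K ⊆ k ⊆ K̄`, `w` an
infinite place of `K` with completion `K_w`, `ι = closureEmb K_w : K̄ → K̄_w` the chosen
embedding, `g ∈ 𝔤_K`, and `k_g = K_w(ι(g k)) ⊆ K̄_w` (the completion of `k` at the place above `w`
determined by `g`).  If `a ∈ kˣ` is totally positive (`ψ a > 0` for every ring homomorphism
`ψ : k → ℝ`), then `ι(g a)` is a `P`-th power in `k_g`: if `w` is complex, `K_w ≅ ℂ` is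
algebraically closed; if `w` is real (`K_w ≅ ℝ`), either `ι(g k)` contains a non-real element and
`k_g = K̄_w`, or `y ↦ Re ι(g y)` is a real embedding of `k`, at which `a > 0` has a real `P`-th
root.  This is the hypothesis of `unitChar_eq_zero_of_exists_pow_eq` /
`map_coresH1_kummerPhi_mem_localRestrictionKer_of_exists_pow_eq` (`PeriodIndexLocalTriviality`)
at the infinite places. [cite: ClarkSharif2010, §3.4 (SC1') with §3.1 (SC1)] -/
theorem exists_mem_adjoin_pow_eq_of_totallyPositive (w : InfinitePlace K) (a : (↥k)ˣ)
    (hpos : ∀ ψ : (↥k) →+* ℝ, 0 < ψ a) (g : absoluteGaloisGroup K) :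
    ∃ r ∈ IntermediateField.adjoin w.Completion
        ((fun y : AlgebraicClosure K ↦ closureEmb (K := K) w.Completion (g • y)) ''
          (k : Set (AlgebraicClosure K))),
      r ^ P = closureEmb (K := K) w.Completion (g • ((a : k) : AlgebraicClosure K)) := by
  rcases w.isReal_or_isComplex with hw | hw
  · -- real place: `K_w ≅ ℝ`
    letI : Algebra w.Completion ℂ := (InfinitePlace.Completion.extensionEmbedding w).toAlgebra
    set e := InfinitePlace.Completion.ringEquivRealOfIsReal hw with he
    have halg : ∀ x : w.Completion, algebraMap w.Completion ℂ x = (e x : ℂ) := fun x ↦ by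
      change InfinitePlace.Completion.extensionEmbedding w x = _
      rw [he, InfinitePlace.Completion.ringEquivRealOfIsReal_apply,
        InfinitePlace.Completion.extensionEmbeddingOfIsReal_apply]
    refine exists_mem_adjoin_pow_eq_of_pos e halg
      ((fun y : AlgebraicClosure K ↦ closureEmb (K := K) w.Completion (g • y)) ''
        (k : Set (AlgebraicClosure K)))
      (x := closureEmb (K := K) w.Completion (g • ((a : k) : AlgebraicClosure K)))
      ⟨((a : k) : AlgebraicClosure K), (a : k).2, rfl⟩ ?_ (NeZero.pos P)
    intro hS
    set j := (IsAlgClosed.lift : AlgebraicClosure w.Completion →ₐ[w.Completion] ℂ) with hj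
    set ι := closureEmb (K := K) w.Completion with hι
    have him : ∀ y : k, (j (ι (g • (y : AlgebraicClosure K)))).im = 0 :=
      fun y ↦ hS _ ⟨y, y.2, rfl⟩
    -- the real embedding of `k` attached to `(w, g)`
    let ψ : (↥k) →+* ℝ :=
      { toFun := fun y ↦ (j (ι (g • (y : AlgebraicClosure K)))).re
        map_one' := by
          simp only [OneMemClass.coe_one, smul_one, map_one, Complex.one_re]
        map_mul' := fun y y' ↦ by
          simp only [MulMemClass.coe_mul, smul_mul', map_mul, Complex.mul_re, him, mul_zero,
            sub_zero]
        map_zero' := by simp only [ZeroMemClass.coe_zero, smul_zero, map_zero, Complex.zero_re]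
        map_add' := fun y y' ↦ by
          simp only [AddMemClass.coe_add, smul_add, map_add, Complex.add_re] }
    exact hpos ψ
  · -- complex place: `K_w ≅ ℂ` is algebraically closed
    haveI : IsAlgClosed w.Completion :=
      isAlgClosed_of_ringEquiv_complex (InfinitePlace.Completion.ringEquivComplexOfIsComplex hw)
    obtain ⟨r, hr, hrP⟩ := exists_mem_pow_eq_of_isAlgClosed
      (IntermediateField.adjoin w.Completion
        ((fun y : AlgebraicClosure K ↦ closureEmb (K := K) w.Completion (g • y)) ''
          (k : Set (AlgebraicClosure K))))
      (closureEmb (K := K) w.Completion (g • ((a : k) : AlgebraicClosure K))) (NeZero.pos P)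
    exact ⟨r, hr, hrP⟩

end InfinitePlaces

section Elliptic

variable {K : Type u} [Field K] {k : IntermediateField K (AlgebraicClosure K)} {P : ℕ} [NeZero P]
  {ζ : AlgebraicClosure K}
variable [(fixingGal k).Normal] [Fintype (absoluteGaloisGroup K ⧸ fixingGal k)]
variable {M : Type u} [AddCommGroup M] [DistribMulAction (absoluteGaloisGroup K) M]
  [TopologicalSpace M] [DiscreteTopology M]

/-- **Local triviality of `η = α_* cores Φ(a, b)` at the infinite places for totally positive
`a, b`** (Clark–Sharif §3.6 last paragraph at `v ∈ S_K` archimedean, via (SC1')): in the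
notation of `map_coresH1_kummerPhi_mem_localRestrictionKer` (`PeriodIndexLocalTriviality`), if
`a, b ∈ kˣ` are totally positive then `η ∈ W.localRestrictionKer K_w` for every infinite place
`w` of `K`. [cite: ClarkSharif2010, §3.6 (last paragraph) with §3.4 (SC1')] -/
theorem map_coresH1_kummerPhi_mem_localRestrictionKer_infinitePlace (W : WeierstrassCurve K)
    (w : InfinitePlace K) (hζ : IsPrimitiveRoot ζ P) (hζk : ζ ∈ k)
    (htriv : ∀ (n : fixingGal k) (m : M), n • m = m) (ρ : ZMod P × ZMod P →+ M) (a b : (↥k)ˣ)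
    (hN : IsOpen (fixingGal k : Set (absoluteGaloisGroup K)))
    (α : M →+ WeierstrassCurve.geomPoints W)
    (hα : ∀ (g : absoluteGaloisGroup K) (m : M), α (g • m) = g • α m)
    (ha : ∀ ψ : (↥k) →+* ℝ, 0 < ψ a) (hb : ∀ ψ : (↥k) →+* ℝ, 0 < ψ b) :
    resH1Hom (ContinuousMonoidHom.id (absoluteGaloisGroup K)) α hα
        (coresH1 (fixingGal k) hN (kummerPhi hζ hζk htriv ρ a b)) ∈
      W.localRestrictionKer w.Completion :=
  map_coresH1_kummerPhi_mem_localRestrictionKer_of_exists_pow_eq W w.Completion hζ hζk htriv ρ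
    a b hN α hα fun g ↦ ⟨exists_mem_adjoin_pow_eq_of_totallyPositive w a ha g,
      exists_mem_adjoin_pow_eq_of_totallyPositive w b hb g⟩

end Elliptic

end Literature.NumberTheory.EllipticCurves
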